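import Summits.QuantumFields.QCD.Theorems.PauliWegnerSeaFMClosureUnquenchedDefs
import Literature.MathematicalPhysics.QuantumFieldTheory.QCDPhaseQuenched

/-!
# Crux `FMClosureUnquenched` (stmt-QuantumFields-11512), line `von-mises-circles`, stub `stub_twoStar` —
helper 2: algebra of trigonometric / fibre polynomials

The registered vocabulary `IsTrigPoly d f` (`f θ = ∑_{|k| ≤ d} c_k e^{ikθ}`) and `IsFibrePoly d F` (continuous,
and `IsTrigPoly d` along every conjugate one-link circle) of
`Theorems/PauliWegnerSeaFMClosureUnquenchedDefs.lean` is closed under the operations the two-star package uses: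
constants (`trigPoly_const`, `fibrePoly_const`), raising the degree (`trigPoly_mono`, `fibrePoly_mono`),
products (`trigPoly_mul`, `fibrePoly_mul`: degrees add) and finite products (`trigPoly_prod`,
`fibrePoly_prod`: degree `#s · d`).  Used for `det diracMatrix = ∏_f det D_f` (degree `4 N_f`) and for the
constant tilt `P = 1` in clause (Tinv).

References: elementary; Katznelson, *An Introduction to Harmonic Analysis*, I.1 (trigonometric polynomials) for
the vocabulary [folklore].
-/

noncomputable section

open scoped BigOperators
open Finset
open Literature.MathematicalPhysics.QuantumFieldTheory Literature.MathematicalPhysics.QuantumLattice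
  Literature.Probability.LatticeModels
open Summit.QuantumFields.QCD.Theorems.VonMisesCircles

namespace Summit.QuantumFields.QCD.Theorems.VonMisesCirclesC1

/-! ## Trigonometric polynomials -/

/-- A constant is a trigonometric polynomial of every degree. [folklore] -/
theorem trigPoly_const (d : ℕ) (a : ℂ) : IsTrigPoly d (fun _ => a) := by
  classical
  refine ⟨fun k => if k = 0 then a else 0, fun θ => ?_⟩
  dsimp only
  rw [Finset.sum_eq_single (0 : ℤ)]
  · simp
  · intro k _ hk
    simp [hk]
  · intro h
    exact absurd (by simp) h

/-- Raising the degree bound. [folklore] -/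
theorem trigPoly_mono {d d' : ℕ} {f : ℝ → ℂ} (h : IsTrigPoly d f) (hd : d ≤ d') :
    IsTrigPoly d' f := by
  classical
  obtain ⟨c, hc⟩ := h
  refine ⟨fun k => if k ∈ Finset.Icc (-(d : ℤ)) d then c k else 0, fun θ => ?_⟩
  dsimp only
  rw [hc θ]
  symm
  rw [← Finset.sum_subset (s₁ := Finset.Icc (-(d : ℤ)) d)]
  · exact Finset.sum_congr rfl fun k hk => by rw [if_pos hk]
  · intro k hk
    rw [Finset.mem_Icc] at hk ⊢
    omega
  · intro k _ hk
    rw [if_neg hk, zero_mul]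

/-- The product of trigonometric polynomials of degrees `≤ d₁`, `≤ d₂` has degree `≤ d₁ + d₂`. [folklore] -/
theorem trigPoly_mul {d₁ d₂ : ℕ} {f g : ℝ → ℂ} (hf : IsTrigPoly d₁ f) (hg : IsTrigPoly d₂ g) :
    IsTrigPoly (d₁ + d₂) (fun θ => f θ * g θ) := by
  classical
  obtain ⟨a, ha⟩ := hf
  obtain ⟨b, hb⟩ := hg
  refine ⟨fun m => ∑ k ∈ Finset.Icc (-(d₁ : ℤ)) d₁, ∑ l ∈ Finset.Icc (-(d₂ : ℤ)) d₂,
    if k + l = m then a k * b l else 0, fun θ => ?_⟩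
  dsimp only
  rw [ha θ, hb θ, Finset.sum_mul_sum]
  symm
  calc ∑ m ∈ Finset.Icc (-((d₁ + d₂ : ℕ) : ℤ)) (d₁ + d₂ : ℕ),
        (∑ k ∈ Finset.Icc (-(d₁ : ℤ)) d₁, ∑ l ∈ Finset.Icc (-(d₂ : ℤ)) d₂,
          if k + l = m then a k * b l else 0) * Complex.exp ((m : ℂ) * (θ : ℂ) * Complex.I)
      = ∑ m ∈ Finset.Icc (-((d₁ + d₂ : ℕ) : ℤ)) (d₁ + d₂ : ℕ),
          ∑ k ∈ Finset.Icc (-(d₁ : ℤ)) d₁, ∑ l ∈ Finset.Icc (-(d₂ : ℤ)) d₂,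
            if k + l = m then a k * b l * Complex.exp ((m : ℂ) * (θ : ℂ) * Complex.I) else 0 := by
        refine Finset.sum_congr rfl fun m _ => ?_
        rw [Finset.sum_mul]
        refine Finset.sum_congr rfl fun k _ => ?_
        rw [Finset.sum_mul]
        refine Finset.sum_congr rfl fun l _ => ?_
        split_ifs <;> simp
    _ = ∑ k ∈ Finset.Icc (-(d₁ : ℤ)) d₁, ∑ l ∈ Finset.Icc (-(d₂ : ℤ)) d₂,
          ∑ m ∈ Finset.Icc (-((d₁ + d₂ : ℕ) : ℤ)) (d₁ + d₂ : ℕ),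
            if k + l = m then a k * b l * Complex.exp ((m : ℂ) * (θ : ℂ) * Complex.I) else 0 := by
        rw [Finset.sum_comm]
        exact Finset.sum_congr rfl fun k _ => Finset.sum_comm
    _ = ∑ k ∈ Finset.Icc (-(d₁ : ℤ)) d₁, ∑ l ∈ Finset.Icc (-(d₂ : ℤ)) d₂,
          a k * Complex.exp ((k : ℂ) * (θ : ℂ) * Complex.I) *
            (b l * Complex.exp ((l : ℂ) * (θ : ℂ) * Complex.I)) := by
        refine Finset.sum_congr rfl fun k hk => Finset.sum_congr rfl fun l hl => ?_
        rw [Finset.sum_ite_eq, if_pos]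
        · rw [mul_mul_mul_comm, ← Complex.exp_add]
          congr 2
          push_cast
          ring
        · rw [Finset.mem_Icc] at hk hl ⊢
          push_cast
          omega

/-- A finite product of trigonometric polynomials of degree `≤ d` has degree `≤ #s · d`. [folklore] -/
theorem trigPoly_prod {ι : Type*} [DecidableEq ι] (s : Finset ι) (F : ι → ℝ → ℂ) (d : ℕ)
    (h : ∀ i ∈ s, IsTrigPoly d (F i)) : IsTrigPoly (s.card * d) (fun θ => ∏ i ∈ s, F i θ) := by
  induction s using Finset.induction_on with
  | empty => simpa using trigPoly_const 0 1
  | insert i s hi ih =>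
    have h1 : IsTrigPoly d (F i) := h i (Finset.mem_insert_self i s)
    have h2 : IsTrigPoly (s.card * d) (fun θ => ∏ j ∈ s, F j θ) :=
      ih fun j hj => h j (Finset.mem_insert_of_mem hj)
    have h3 := trigPoly_mul h1 h2
    simp_rw [Finset.prod_insert hi]
    refine trigPoly_mono h3 ?_
    rw [Finset.card_insert_of_notMem hi]
    nlinarith

/-! ## Fibre polynomials -/

variable {N : ℕ}

/-- A constant is a fibre polynomial of every degree. [folklore] -/
theorem fibrePoly_const (d : ℕ) (a : ℂ) :
    IsFibrePoly (N := N) d (fun _ : GaugeConfig 4 N (Matrix.specialUnitaryGroup (Fin 3) ℂ) => a) :=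
  ⟨continuous_const, fun _ _ _ _ _ _ => trigPoly_const d a⟩

/-- Raising the degree bound of a fibre polynomial. [folklore] -/
theorem fibrePoly_mono {d d' : ℕ} {F : GaugeConfig 4 N (Matrix.specialUnitaryGroup (Fin 3) ℂ) → ℂ}
    (h : IsFibrePoly d F) (hd : d ≤ d') : IsFibrePoly d' F :=
  ⟨h.1, fun W e V B T hT => trigPoly_mono (h.2 W e V B T hT) hd⟩

/-- Products of fibre polynomials are fibre polynomials; degrees add. [folklore] -/
theorem fibrePoly_mul {d₁ d₂ : ℕ} {F G : GaugeConfig 4 N (Matrix.specialUnitaryGroup (Fin 3) ℂ) → ℂ}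
    (hF : IsFibrePoly d₁ F) (hG : IsFibrePoly d₂ G) : IsFibrePoly (d₁ + d₂) (fun W => F W * G W) :=
  ⟨hF.1.mul hG.1, fun W e V B T hT => trigPoly_mul (hF.2 W e V B T hT) (hG.2 W e V B T hT)⟩

/-- Finite products of fibre polynomials of degree `≤ d` are fibre polynomials of degree `≤ #s · d`.
[folklore] -/
theorem fibrePoly_prod {ι : Type*} [DecidableEq ι] (s : Finset ι)
    (F : ι → GaugeConfig 4 N (Matrix.specialUnitaryGroup (Fin 3) ℂ) → ℂ) (d : ℕ)
    (h : ∀ i ∈ s, IsFibrePoly d (F i)) : IsFibrePoly (s.card * d) (fun W => ∏ i ∈ s, F i W) :=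
  ⟨continuous_finsetProd s fun i hi => (h i hi).1,
    fun W e V B T hT => trigPoly_prod s
      (fun i θ => F i (Function.update W e (W e * (V * T θ * V⁻¹) * B))) d
      fun i hi => (h i hi).2 W e V B T hT⟩

/-- The norm of a fibre polynomial is continuous (used for suprema over the compact fibre). [folklore] -/
theorem fibrePoly_continuous_norm {d : ℕ} {F : GaugeConfig 4 N (Matrix.specialUnitaryGroup (Fin 3) ℂ) → ℂ}
    (hF : IsFibrePoly d F) : Continuous fun W => ‖F W‖ :=
  hF.1.norm

/-! ## Side matrices: pointwise toolkit -/

/-- The side matrix of the whole torus is the matrix itself. [folklore] -/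
theorem sideMatrix_univ [NeZero N] (M : Matrix (QIdx N) (QIdx N) ℂ) : sideMatrix Finset.univ M = M := by
  ext p q
  simp [sideMatrix]

/-- Block norms are non-negative. [folklore] -/
theorem blockNorm_nonneg (M : Matrix (QIdx N) (QIdx N) ℂ) (x y : TorusSite 4 N) : 0 ≤ blockNorm M x y :=
  Finset.sum_nonneg fun _ _ => Finset.sum_nonneg fun _ _ => Finset.sum_nonneg fun _ _ =>
    Finset.sum_nonneg fun _ _ => norm_nonneg _

/-- Block norms of a scalar multiple. [folklore] -/
theorem blockNorm_smul (c : ℂ) (M : Matrix (QIdx N) (QIdx N) ℂ) (x y : TorusSite 4 N) :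
    blockNorm (c • M) x y = ‖c‖ * blockNorm M x y := by
  simp only [blockNorm, Matrix.smul_apply, smul_eq_mul, norm_mul, Finset.mul_sum]

/-- A single entry is bounded by the block norm of its block. [folklore] -/
theorem norm_apply_le_blockNorm (M : Matrix (QIdx N) (QIdx N) ℂ) (x y : TorusSite 4 N) (a b : Fin 3)
    (i j : Fin 4) : ‖M (x, a, i) (y, b, j)‖ ≤ blockNorm M x y := by
  unfold blockNorm
  refine le_trans ?_ (Finset.single_le_sum (f := fun a => ∑ i : Fin 4, ∑ b : Fin 3, ∑ j : Fin 4,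
    ‖M (x, a, i) (y, b, j)‖) (fun _ _ => Finset.sum_nonneg fun _ _ => Finset.sum_nonneg fun _ _ =>
    Finset.sum_nonneg fun _ _ => norm_nonneg _) (Finset.mem_univ a))
  refine le_trans ?_ (Finset.single_le_sum (f := fun i => ∑ b : Fin 3, ∑ j : Fin 4,
    ‖M (x, a, i) (y, b, j)‖) (fun _ _ => Finset.sum_nonneg fun _ _ =>
    Finset.sum_nonneg fun _ _ => norm_nonneg _) (Finset.mem_univ i))
  refine le_trans ?_ (Finset.single_le_sum (f := fun b => ∑ j : Fin 4,
    ‖M (x, a, i) (y, b, j)‖) (fun _ _ => Finset.sum_nonneg fun _ _ => norm_nonneg _) (Finset.mem_univ b))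
  exact Finset.single_le_sum (f := fun j => ‖M (x, a, i) (y, b, j)‖) (fun _ _ => norm_nonneg _)
    (Finset.mem_univ j)

/-- If every entry of a block is bounded by `c` then the block norm is bounded by `144 c`. [folklore] -/
theorem blockNorm_le_of_forall_le (M : Matrix (QIdx N) (QIdx N) ℂ) (x y : TorusSite 4 N) (c : ℝ)
    (h : ∀ (a b : Fin 3) (i j : Fin 4), ‖M (x, a, i) (y, b, j)‖ ≤ c) : blockNorm M x y ≤ 144 * c := by
  unfold blockNorm
  calc ∑ a : Fin 3, ∑ i : Fin 4, ∑ b : Fin 3, ∑ j : Fin 4, ‖M (x, a, i) (y, b, j)‖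
      ≤ ∑ _a : Fin 3, ∑ _i : Fin 4, ∑ _b : Fin 3, ∑ _j : Fin 4, c :=
        Finset.sum_le_sum fun a _ => Finset.sum_le_sum fun i _ => Finset.sum_le_sum fun b _ =>
          Finset.sum_le_sum fun j _ => h a b i j
    _ = 144 * c := by simp only [Finset.sum_const, Finset.card_univ, Fintype.card_fin]; ring

/-- **Cramer**: the block norms of the inverse are those of the adjugate divided by `|det|` (both sides vanish
at singular matrices, where `Matrix.inv` is the junk `0` and `0⁻¹ = 0`). [folklore] -/
theorem blockNorm_inv [NeZero N] (M : Matrix (QIdx N) (QIdx N) ℂ) (x y : TorusSite 4 N) :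
    blockNorm M⁻¹ x y = ‖M.det‖⁻¹ * blockNorm M.adjugate x y := by
  rw [Matrix.inv_def, Ring.inverse_eq_inv, blockNorm_smul, norm_inv]

/-- Fractional powers of the block norms of the inverse: `‖M⁻¹‖^t = ‖adj M‖^t · |det M|^{-t}`. [folklore] -/
theorem blockNorm_inv_rpow [NeZero N] (M : Matrix (QIdx N) (QIdx N) ℂ) (x y : TorusSite 4 N) (t : ℝ) :
    blockNorm M⁻¹ x y ^ t = blockNorm M.adjugate x y ^ t * ‖M.det‖ ^ (-t) := by
  rw [blockNorm_inv, Real.mul_rpow (inv_nonneg.2 (norm_nonneg _)) (blockNorm_nonneg _ _ _),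
    Real.inv_rpow (norm_nonneg _), Real.rpow_neg (norm_nonneg _), mul_comm]

/-- At a singular matrix the block norms of the (junk) inverse vanish. [folklore] -/
theorem blockNorm_inv_of_det_eq_zero [NeZero N] (M : Matrix (QIdx N) (QIdx N) ℂ) (x y : TorusSite 4 N)
    (h : M.det = 0) : blockNorm M⁻¹ x y = 0 := by
  rw [blockNorm_inv, h, norm_zero, inv_zero, zero_mul]

/-- **Locality of the Wilson–Dirac matrix**: the entry `D_{pq}` reads only the links joining the sites of `p`
and `q`. [folklore] -/
theorem wilsonD_apply_congr [NeZero N] (U V : GaugeConfig 4 N (Matrix.specialUnitaryGroup (Fin 3) ℂ)) (m : ℝ)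
    (p q : QIdx N)
    (h : ∀ μ : Fin 4, (q.1 = Site.shift p.1 μ → U (p.1, μ) = V (p.1, μ)) ∧
      (p.1 = Site.shift q.1 μ → U (q.1, μ) = V (q.1, μ))) :
    wilsonD U m p q = wilsonD V m p q := by
  simp only [wilsonD, wilsonDirac, Matrix.of_apply]
  congr 1
  congr 1
  refine Finset.sum_congr rfl fun μ _ => ?_
  obtain ⟨h1, h2⟩ := h μ
  congr 1
  · split_ifs with hc
    · rw [h1 hc]
    · rfl
  · split_ifs with hc
    · rw [h2 hc]
    · rfl

/-- **Locality of side matrices**: `D_A ⊕ 1` reads only the links with both endpoints in `A`. [folklore] -/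
theorem sideMatrix_wilsonD_congr [NeZero N] (A : Finset (TorusSite 4 N))
    (U V : GaugeConfig 4 N (Matrix.specialUnitaryGroup (Fin 3) ℂ)) (m : ℝ)
    (h : ∀ e : Edge 4 N, e.1 ∈ A → Site.shift e.1 e.2 ∈ A → U e = V e) :
    sideMatrix A (wilsonD U m) = sideMatrix A (wilsonD V m) := by
  ext p q
  simp only [sideMatrix, Matrix.of_apply]
  split_ifs with hpq
  · refine wilsonD_apply_congr U V m p q fun μ => ⟨fun hq => ?_, fun hp => ?_⟩
    · exact h (p.1, μ) hpq.1 (hq ▸ hpq.2)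
    · exact h (q.1, μ) hpq.2 (hp ▸ hpq.1)
  · rfl
  · rfl

/-- The rows and columns of `(D_A ⊕ 1)⁻¹` outside `A` are those of the identity (or `0` at a singular side
matrix); in particular every such entry has norm `≤ 1`. [folklore] -/
theorem norm_gside_apply_le_one [NeZero N] (A : Finset (TorusSite 4 N)) (M : Matrix (QIdx N) (QIdx N) ℂ)
    (p q : QIdx N) (h : p.1 ∉ A ∨ q.1 ∉ A) : ‖gside A M p q‖ ≤ 1 := by
  unfold gside
  set Nm := sideMatrix A M with hNm
  by_cases hU : IsUnit Nm.det
  · -- the projector onto the rows/columns outside `A`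
    set P : Matrix (QIdx N) (QIdx N) ℂ := Matrix.diagonal fun r => if r.1 ∈ A then 0 else 1 with hP
    have hPN : P * Nm = P := by
      ext r c
      simp only [hP, hNm, Matrix.diagonal_mul, Matrix.diagonal_apply, sideMatrix, Matrix.of_apply]
      by_cases hrc : r = c
      · subst hrc
        by_cases hr : r.1 ∈ A <;> simp [hr]
      · by_cases hr : r.1 ∈ A <;> simp [hr, hrc]
    have hNP : Nm * P = P := by
      ext r c
      simp only [hP, hNm, Matrix.mul_diagonal, Matrix.diagonal_apply, sideMatrix, Matrix.of_apply]
      by_cases hrc : r = c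
      · subst hrc
        by_cases hr : r.1 ∈ A <;> simp [hr]
      · by_cases hc : c.1 ∈ A <;> simp [hc, hrc]
    have hrow : P * Nm⁻¹ = P := by
      calc P * Nm⁻¹ = P * Nm * Nm⁻¹ := by rw [hPN]
        _ = P := by rw [Matrix.mul_assoc, Matrix.mul_nonsing_inv _ hU, Matrix.mul_one]
    have hcol : Nm⁻¹ * P = P := by
      calc Nm⁻¹ * P = Nm⁻¹ * (Nm * P) := by rw [hNP]
        _ = P := by rw [← Matrix.mul_assoc, Matrix.nonsing_inv_mul _ hU, Matrix.one_mul]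
    rcases h with hp | hq
    · have key := congrFun (congrFun hrow p) q
      simp only [hP, Matrix.diagonal_mul, Matrix.diagonal_apply, hp, if_false, one_mul] at key
      rw [key]
      split_ifs <;> simp
    · have key := congrFun (congrFun hcol p) q
      simp only [hP, Matrix.mul_diagonal, Matrix.diagonal_apply, hq, if_false, mul_one] at key
      rw [key]
      split_ifs <;> simp
  · rw [Matrix.nonsing_inv_apply_not_isUnit _ hU]
    simp

/-- Block norms of the side-wise Green function with a site outside `A` are bounded by `144`. [folklore] -/
theorem blockNorm_gside_le_of_not_mem [NeZero N] (A : Finset (TorusSite 4 N))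
    (M : Matrix (QIdx N) (QIdx N) ℂ) (x y : TorusSite 4 N) (h : x ∉ A ∨ y ∉ A) :
    blockNorm (gside A M) x y ≤ 144 := by
  have := blockNorm_le_of_forall_le (gside A M) x y 1 fun a b i j =>
    norm_gside_apply_le_one A M (x, a, i) (y, b, j) h
  linarith

/-- Side matrices of the Wilson–Dirac matrix depend continuously on the gauge field. [folklore] -/
theorem continuous_sideMatrix_wilsonD [NeZero N] (A : Finset (TorusSite 4 N)) (m : ℝ) :
    Continuous fun U : GaugeConfig 4 N (Matrix.specialUnitaryGroup (Fin 3) ℂ) => sideMatrix A (wilsonD U m) := by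
  refine continuous_pi fun p => continuous_pi fun q => ?_
  simp only [sideMatrix, Matrix.of_apply]
  split_ifs
  · exact (continuous_wilsonDirac (fundamentalRep (Fin 3)) (continuous_fundamentalRep (Fin 3)) m 1).matrix_elem
      p q
  · exact continuous_const
  · exact continuous_const

/-- Refitting a frozen outside field with free links on `R` is continuous in the free links. [folklore] -/
theorem continuous_refit (R : Finset (Edge 4 N)) (U : GaugeConfig 4 N (Matrix.specialUnitaryGroup (Fin 3) ℂ)) :
    Continuous fun W : GaugeConfig 4 N (Matrix.specialUnitaryGroup (Fin 3) ℂ) =>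
      (fun e => if e ∈ R then W e else U e : GaugeConfig 4 N (Matrix.specialUnitaryGroup (Fin 3) ℂ)) := by
  refine continuous_pi fun e => ?_
  split_ifs
  · exact continuous_apply e
  · exact continuous_const

/-- Refitting is measurable in the free links. [folklore] -/
theorem measurable_refit (R : Finset (Edge 4 N)) (U : GaugeConfig 4 N (Matrix.specialUnitaryGroup (Fin 3) ℂ)) :
    Measurable fun W : GaugeConfig 4 N (Matrix.specialUnitaryGroup (Fin 3) ℂ) =>
      (fun e => if e ∈ R then W e else U e : GaugeConfig 4 N (Matrix.specialUnitaryGroup (Fin 3) ℂ)) := by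
  refine measurable_pi_lambda _ fun e => ?_
  split_ifs
  · exact measurable_pi_apply e
  · exact measurable_const

/-- **K1♭ on a super-fibre.**  Local cofactor domination bounds the adjugate block of `D_A ⊕ 1` at `(x, y)` by
`C₀` times the supremum of `|det (D_A ⊕ 1)|` over ANY fibre whose free links contain the two stars of `x` and
`y` (the sup over a larger fibre is larger). [folklore] -/
theorem adj_blockNorm_le_sup_of_localCofactorDomination (hK : LocalCofactorDomination) :
    ∃ C₀ : ℝ, 0 < C₀ ∧ ∀ (m₀ : ℝ), -9 ≤ m₀ → m₀ ≤ 1 →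
      ∀ (S : ℕ) (A : Finset (TorusSite 4 (2 * S + 1))), AdmissibleSide S A →
      ∀ (x y : TorusSite 4 (2 * S + 1)), x ∈ A → y ∈ A →
      ∀ (R : Finset (Edge 4 (2 * S + 1))),
        (∀ e : Edge 4 (2 * S + 1),
          (e.1 = x ∨ Site.shift e.1 e.2 = x ∨ e.1 = y ∨ Site.shift e.1 e.2 = y) → e ∈ R) →
      ∀ (U W : GaugeConfig 4 (2 * S + 1) (Matrix.specialUnitaryGroup (Fin 3) ℂ)),
        blockNorm ((sideMatrix A (wilsonD (fun e => if e ∈ R then W e else U e) m₀)).adjugate) x y ≤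
          C₀ * ⨆ W' : GaugeConfig 4 (2 * S + 1) (Matrix.specialUnitaryGroup (Fin 3) ℂ),
            ‖(sideMatrix A (wilsonD (fun e => if e ∈ R then W' e else U e) m₀)).det‖ := by
  obtain ⟨C₀, hC₀, hK⟩ := hK
  refine ⟨C₀, hC₀, fun m₀ hm₁ hm₂ S A hA x y hx hy R hR U W => ?_⟩
  set V : GaugeConfig 4 (2 * S + 1) (Matrix.specialUnitaryGroup (Fin 3) ℂ) :=
    fun e => if e ∈ R then W e else U e with hV
  obtain ⟨W', hW'⟩ := hK m₀ hm₁ hm₂ S V A hA x y hx hy V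
  -- the K1♭ refit of `V` by `V` is `V` itself
  simp only [ite_self] at hW'
  -- the K1♭ refit of `V` by `W'` lies in the fibre over `U`
  set W₁ : GaugeConfig 4 (2 * S + 1) (Matrix.specialUnitaryGroup (Fin 3) ℂ) := fun e =>
    if e.1 = x ∨ Site.shift e.1 e.2 = x ∨ e.1 = y ∨ Site.shift e.1 e.2 = y then W' e else W e with hW₁
  have h2 : (fun e : Edge 4 (2 * S + 1) =>
      if e.1 = x ∨ Site.shift e.1 e.2 = x ∨ e.1 = y ∨ Site.shift e.1 e.2 = y then W' e else V e) =
      fun e => if e ∈ R then W₁ e else U e := by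
    funext e
    by_cases hs : e.1 = x ∨ Site.shift e.1 e.2 = x ∨ e.1 = y ∨ Site.shift e.1 e.2 = y
    · rw [if_pos hs, if_pos (hR e hs), hW₁]
      simp only [hs, if_true]
    · rw [if_neg hs, hV, hW₁]
      simp only [hs, if_false]
  have hcont : Continuous fun W' : GaugeConfig 4 (2 * S + 1) (Matrix.specialUnitaryGroup (Fin 3) ℂ) =>
      ‖(sideMatrix A (wilsonD (fun e => if e ∈ R then W' e else U e) m₀)).det‖ :=
    ((continuous_sideMatrix_wilsonD A m₀).comp (continuous_refit R U)).matrix_det.norm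
  calc blockNorm ((sideMatrix A (wilsonD V m₀)).adjugate) x y
      ≤ C₀ * ‖(sideMatrix A (wilsonD (fun e : Edge 4 (2 * S + 1) =>
          if e.1 = x ∨ Site.shift e.1 e.2 = x ∨ e.1 = y ∨ Site.shift e.1 e.2 = y then W' e else V e)
            m₀)).det‖ := hW'
    _ = C₀ * ‖(sideMatrix A (wilsonD (fun e => if e ∈ R then W₁ e else U e) m₀)).det‖ := by rw [h2]
    _ ≤ _ := mul_le_mul_of_nonneg_left (le_ciSup (isCompact_range hcont).bddAbove W₁) hC₀.le

/-- **Registered helper `stub_twoStar_aux2` of crux stmt-QuantumFields-11512** (line `von-mises-circles`, stub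
`stub_twoStar`): K1♭ (`LocalCofactorDomination`) transported to every super-fibre of the two stars — the form in
which clauses (T5), (Tdec), (T1), (T0) of `TwoStarBounds` consume it. [folklore] -/
theorem stub_twoStar_aux2 : LocalCofactorDomination → ∃ C₀ : ℝ, 0 < C₀ ∧ ∀ (m₀ : ℝ), -9 ≤ m₀ → m₀ ≤ 1 → ∀ (S : ℕ) (A : Finset (TorusSite 4 (2 * S + 1))), AdmissibleSide S A → ∀ (x y : TorusSite 4 (2 * S + 1)), x ∈ A → y ∈ A → ∀ (R : Finset (Edge 4 (2 * S + 1))), (∀ e : Edge 4 (2 * S + 1), (e.1 = x ∨ Site.shift e.1 e.2 = x ∨ e.1 = y ∨ Site.shift e.1 e.2 = y) → e ∈ R) → ∀ (U W : GaugeConfig 4 (2 * S + 1) (Matrix.specialUnitaryGroup (Fin 3) ℂ)), blockNorm ((sideMatrix A (wilsonD (fun e => if e ∈ R then W e else U e) m₀)).adjugate) x y ≤ C₀ * ⨆ W' : GaugeConfig 4 (2 * S + 1) (Matrix.specialUnitaryGroup (Fin 3) ℂ), ‖(sideMatrix A (wilsonD (fun e => if e ∈ R then W' e else U e) m₀)).det‖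 :=
  adj_blockNorm_le_sup_of_localCofactorDomination

end Summit.QuantumFields.QCD.Theorems.VonMisesCirclesC1
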